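import Mathlib
import Summits.AtomisticToContinuum.HydrodynamicLimit.Theorems.InformationPercolationEngineKickFairRelEquilibriumMesoFairGivenPast
import HarnessLib

/-!
# `KickFairRelEquilibriumMeso`, line `Sketch` — THE RESTART BIAS IS A CORRELATION WITH THE INNOVATION OF THE TIME-ZERO KEY
# (what is left of the stub R-i″ after exact fairness given the past)

Helper file (`--supports stmt-AtomisticToContinuum-15177`, registered sub-goal `biasInnovation`) of the line lead (continuation c2).
By `…MesoFairGivenPast` every windowed centred kick term `T_{i,n}` of the crux has `G`-mean zero against every bounded measurable
function of its own past. Hence for every measurable event `B` (in the stub R-i″: a level set of the time-zero key) the restart bias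
`∫_B T_{i,n} dG` equals `∫ (1_B − G[1_B | σ(P_{i,n})]) T_{i,n} dG` (`setIntegral_windowTerm_eq_integral_innovation`): only the part of
`1_B` that is NOT predictable from the mesoscopic past — its innovation — can correlate with the centred kick. The predictable part
`G[1_B | σ(P)]` is a bounded measurable function of the past by Doob–Dynkin (`StronglyMeasurable.exists_eq_measurable_comp`, clipped to
`[0,1]`), so it integrates to zero against `T_{i,n}` (`integral_windowTerm_eq_zero`). This is the precise form in which R-i″ is a
Boltzmann-hypothesis-class statement: ONE impact vector must carry `o(1)` information (in covariance, relative to `G(B)`) about the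
time-zero key beyond the mesoscopic past.
-/

noncomputable section

open MeasureTheory Set Filter Topology
open scoped ENNReal Classical

namespace Summit.AtomisticToContinuum.HydrodynamicLimit.Theorems.KickFairRelEquilibriumMesoLine

open Literature.Analysis.FluidPDE Literature.MathematicalPhysics.KineticTheory
open Summit.AtomisticToContinuum.HydrodynamicLimit.Theorems

variable {σ : ℝ} {N : ℕ}

/-- **The restart bias on an event is the correlation of the centred kick with the event's INNOVATION beyond the past.** For every
measurable `B ⊆ Phase N` and every index: `∫_B T_{i,n} dG = ∫ (1_B − G[1_B | σ(P_{i,n})]) · T_{i,n} dG`, where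
`T_{i,n} = 1{n < cnt_i} 1{t_{i,n} ∈ (t₁,t₂]} h(P_{i,n}) (g(X_{i,n}) − κ_{i,n})` is the crux's windowed summand: the part of `1_B` that is
predictable from the past integrates to zero against `T_{i,n}` (`integral_windowTerm_eq_zero` with the weight `G[1_B|σ(P)]·h`, a bounded
measurable function of the past by Doob–Dynkin). So the stub R-i″ asks exactly that ONE impact vector carry `o(1)` information (in this
covariance sense, relative to `G(B)`) about the time-zero key beyond what the mesoscopic past already tells. [folklore] -/
theorem setIntegral_windowTerm_eq_integral_innovation (hσ : 0 < σ) (hσ2 : σ ≤ 1 / 2) (Φ : Flow σ N) (τ r t₁ t₂ : ℝ)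
    {g : V3 × V3 × V3 → ℝ} (hg : Continuous g) (hgb : ∃ C : ℝ, ∀ p, |g p| ≤ C)
    {h : Fin (N + 1) → ℕ → Past N → ℝ} (hh : ∀ i n, Measurable (h i n)) (hhb : ∃ Ch : ℝ, ∀ i n p, |h i n p| ≤ Ch)
    {B : Set (Phase N)} (hB : MeasurableSet B) (i : Fin (N + 1)) (n : ℕ) :
    ∫ z in B, (if n < cnt Φ τ z i then
        (if t₁ < Φ.nthCollisionTimeOf i n z ∧ Φ.nthCollisionTimeOf i n z ≤ t₂ then (1 : ℝ) else 0) *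
          (h i n (past Φ r z i n) * (g (kick Φ i n z) - kappa Φ r g i n z)) else 0)
      ∂(localGibbsLaw σ (fun _ => 1) (fun _ => 0) (fun _ => 1) N Φ) =
    ∫ z, (B.indicator (fun _ => (1 : ℝ)) z -
        ((localGibbsLaw σ (fun _ => 1) (fun _ => 0) (fun _ => 1) N Φ)[B.indicator (fun _ => (1 : ℝ)) |
          MeasurableSpace.comap (fun z => past Φ r z i n) inferInstance]) z) *
      (if n < cnt Φ τ z i then
        (if t₁ < Φ.nthCollisionTimeOf i n z ∧ Φ.nthCollisionTimeOf i n z ≤ t₂ then (1 : ℝ) else 0) *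
          (h i n (past Φ r z i n) * (g (kick Φ i n z) - kappa Φ r g i n z)) else 0)
      ∂(localGibbsLaw σ (fun _ => 1) (fun _ => 0) (fun _ => 1) N Φ) := by
  obtain ⟨C, hC⟩ := hgb
  obtain ⟨Ch, hCh⟩ := hhb
  have hC0 : 0 ≤ C := (abs_nonneg _).trans (hC 0)
  have hCh0 : 0 ≤ Ch := (abs_nonneg _).trans (hCh i n ((((fun _ => (0, 0)), fun _ => (0, 0)), 0), (0, 0, 0)))
  set ν : Measure (Phase N) := localGibbsLaw σ (fun _ => (1 : ℝ)) (fun _ => (0 : V3)) (fun _ => (1 : ℝ)) N Φ with hν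
  haveI : IsProbabilityMeasure ν := isProbabilityMeasure_localGibbsLaw continuous_const continuous_const
    continuous_const (fun _ => one_pos) (fun _ => one_pos) hσ2 N Φ
  have hgood : ∀ᵐ z ∂ν, z ∈ Φ.good := mem_ae_iff.2 (localGibbsLaw_compl_good_eq_zero Φ)
  have hmle : MeasurableSpace.comap (fun z => past Φ r z i n) inferInstance ≤
      (inferInstance : MeasurableSpace (Phase N)) := comap_past_le stub_pastMeasurable hσ Φ r i n
  -- the windowed summand for a general weight family: measurability and bound
  obtain ⟨T, hT⟩ : ∃ T : (Fin (N + 1) → ℕ → Past N → ℝ) → Phase N → ℝ, ∀ h' z, T h' z = (if n < cnt Φ τ z i then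
      (if t₁ < Φ.nthCollisionTimeOf i n z ∧ Φ.nthCollisionTimeOf i n z ≤ t₂ then (1 : ℝ) else 0) *
        (h' i n (past Φ r z i n) * (g (kick Φ i n z) - kappa Φ r g i n z)) else 0) := ⟨_, fun _ _ => rfl⟩
  have hT_aesm : ∀ {h' : Fin (N + 1) → ℕ → Past N → ℝ}, (∀ i n, Measurable (h' i n)) → AEStronglyMeasurable (T h') ν := by
    intro h' hh'
    have hmeas : Measurable fun z => (if n < gcnt Φ τ z i then slotTerm Φ r t₁ t₂ g h' i n z else 0) := by
      refine Measurable.ite ?_ (measurable_slotTerm stub_pastMeasurable hσ Φ r t₁ t₂ hg hh' i n) measurable_const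
      exact measurableSet_lt measurable_const ((measurable_from_top (f := fun m : ℕ => m)).comp
        (measurable_gcnt stub_pastMeasurable hσ Φ τ i))
    refine ⟨_, hmeas.stronglyMeasurable, ?_⟩
    filter_upwards [hgood] with z hz
    simp only [hT, gcnt, slotTerm, hz, if_true, pastTime_of_mem_good Φ r hz]
  have hκae := ae_forall_abs_kappa_le Φ r hC
  have hT_bd : ∀ {h' : Fin (N + 1) → ℕ → Past N → ℝ} {C' : ℝ}, 0 ≤ C' → (∀ i n p, |h' i n p| ≤ C') →
      ∀ᵐ z ∂ν, ‖T h' z‖ ≤ C' * (2 * C) := by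
    intro h' C' hC' hh'b
    filter_upwards [hκae] with z hκ
    rw [Real.norm_eq_abs, hT]
    by_cases h1 : n < cnt Φ τ z i
    · rw [if_pos h1]
      by_cases h2 : t₁ < Φ.nthCollisionTimeOf i n z ∧ Φ.nthCollisionTimeOf i n z ≤ t₂
      · rw [if_pos h2, one_mul, abs_mul]
        have h3 : |g (kick Φ i n z) - kappa Φ r g i n z| ≤ 2 * C :=
          (abs_sub _ _).trans (by linarith [hC (kick Φ i n z), hκ i n])
        exact mul_le_mul (hh'b i n _) h3 (abs_nonneg _) hC'
      · rw [if_neg h2, zero_mul, abs_zero]; positivity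
    · rw [if_neg h1, abs_zero]; positivity
  have hT_int : Integrable (T h) ν := Integrable.of_bound (hT_aesm hh) (Ch * (2 * C)) (hT_bd hCh0 hCh)
  -- the predictable part of `1_B`, as a bounded measurable function of the past (Doob–Dynkin, clipped to `[0,1]`)
  have hcsm : StronglyMeasurable[MeasurableSpace.comap (fun z => past Φ r z i n) inferInstance]
      (ν[B.indicator (fun _ => (1 : ℝ)) | MeasurableSpace.comap (fun z => past Φ r z i n) inferInstance]) :=
    stronglyMeasurable_condExp
  obtain ⟨F₀, hF₀m, hF₀⟩ := hcsm.exists_eq_measurable_comp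
  obtain ⟨F, hF⟩ : ∃ F : Past N → ℝ, ∀ p, F p = max 0 (min 1 (F₀ p)) := ⟨_, fun _ => rfl⟩
  have hFm : Measurable F := by
    have : F = fun p => max 0 (min 1 (F₀ p)) := funext hF
    rw [this]
    exact measurable_const.max (measurable_const.min hF₀m.measurable)
  have hF01 : ∀ p, 0 ≤ F p ∧ F p ≤ 1 := fun p => by
    rw [hF]; exact ⟨le_max_left _ _, max_le zero_le_one (min_le_left _ _)⟩
  have hind_int1 : Integrable (B.indicator fun _ => (1 : ℝ)) ν := (integrable_const (1 : ℝ)).indicator hB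
  have hcond01 : ∀ᵐ z ∂ν, 0 ≤ (ν[B.indicator (fun _ => (1 : ℝ)) | MeasurableSpace.comap (fun z => past Φ r z i n) inferInstance]) z ∧
      (ν[B.indicator (fun _ => (1 : ℝ)) | MeasurableSpace.comap (fun z => past Φ r z i n) inferInstance]) z ≤ 1 := by
    have h0 : 0 ≤ᵐ[ν] ν[B.indicator (fun _ => (1 : ℝ)) | MeasurableSpace.comap (fun z => past Φ r z i n) inferInstance] :=
      condExp_nonneg (Eventually.of_forall fun z => Set.indicator_nonneg (fun _ _ => zero_le_one) z)
    have h1 : ν[B.indicator (fun _ => (1 : ℝ)) | MeasurableSpace.comap (fun z => past Φ r z i n) inferInstance] ≤ᵐ[ν]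
        ν[(fun _ => (1 : ℝ)) | MeasurableSpace.comap (fun z => past Φ r z i n) inferInstance] :=
      condExp_mono hind_int1 (integrable_const (1 : ℝ))
        (Eventually.of_forall fun z => Set.indicator_le_self' (fun _ _ => zero_le_one) z)
    filter_upwards [h0, h1] with z hz0 hz1
    refine ⟨hz0, ?_⟩
    rwa [condExp_const hmle (1 : ℝ)] at hz1
  have hFP : (fun z => F (past Φ r z i n)) =ᵐ[ν]
      ν[B.indicator (fun _ => (1 : ℝ)) | MeasurableSpace.comap (fun z => past Φ r z i n) inferInstance] := by
    filter_upwards [hcond01] with z hz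
    have hz' : (ν[B.indicator (fun _ => (1 : ℝ)) | MeasurableSpace.comap (fun z => past Φ r z i n) inferInstance]) z =
        F₀ (past Φ r z i n) := congrFun hF₀ z
    rw [hF, ← hz', min_eq_right hz.2, max_eq_right hz.1]
  -- the weight `F · h` and the vanishing of the predictable part
  obtain ⟨h', hh'def⟩ : ∃ h' : Fin (N + 1) → ℕ → Past N → ℝ, ∀ i n p, h' i n p = F p * h i n p := ⟨_, fun _ _ _ => rfl⟩
  have hh' : ∀ i n, Measurable (h' i n) := fun i n => by
    have : h' i n = fun p => F p * h i n p := funext (hh'def i n)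
    rw [this]; exact hFm.mul (hh i n)
  have hh'b : ∀ i n p, |h' i n p| ≤ Ch := by
    intro i n p
    rw [hh'def, abs_mul, abs_of_nonneg (hF01 p).1]
    calc F p * |h i n p| ≤ 1 * Ch := mul_le_mul (hF01 p).2 (hCh i n p) (abs_nonneg _) zero_le_one
      _ = Ch := one_mul _
  have hzero : ∫ z, T h' z ∂ν = 0 := by
    have h0 := integral_windowTerm_eq_zero hσ hσ2 Φ τ r t₁ t₂ hg ⟨C, hC⟩ hh' ⟨Ch, hh'b⟩ i n
    refine (integral_congr_ae (Eventually.of_forall fun z => ?_)).trans h0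
    exact hT h' z
  have hTh' : ∀ z, T h' z = F (past Φ r z i n) * T h z := by
    intro z
    rw [hT, hT, hh'def]
    split_ifs <;> ring
  have hpred : ∫ z, (ν[B.indicator (fun _ => (1 : ℝ)) | MeasurableSpace.comap (fun z => past Φ r z i n) inferInstance]) z *
      T h z ∂ν = 0 := by
    rw [← hzero]
    refine integral_congr_ae ?_
    filter_upwards [hFP] with z hz
    rw [hTh', hz]
  -- assemble
  have hind_int : Integrable (fun z => B.indicator (fun _ => (1 : ℝ)) z * T h z) ν := by
    refine hT_int.bdd_mul (c := 1) (measurable_const.indicator hB).aestronglyMeasurable (Eventually.of_forall fun z => ?_)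
    rw [Real.norm_eq_abs]
    by_cases hz : z ∈ B <;> simp [hz]
  have hcond_int : Integrable (fun z =>
      (ν[B.indicator (fun _ => (1 : ℝ)) | MeasurableSpace.comap (fun z => past Φ r z i n) inferInstance]) z * T h z) ν := by
    refine hT_int.bdd_mul (c := 1) ?_ ?_
    · exact (stronglyMeasurable_condExp.mono hmle).aestronglyMeasurable
    · filter_upwards [hcond01] with z hz
      rw [Real.norm_eq_abs, abs_of_nonneg hz.1]
      exact hz.2
  have hLHS : ∫ z in B, (if n < cnt Φ τ z i then
        (if t₁ < Φ.nthCollisionTimeOf i n z ∧ Φ.nthCollisionTimeOf i n z ≤ t₂ then (1 : ℝ) else 0) *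
          (h i n (past Φ r z i n) * (g (kick Φ i n z) - kappa Φ r g i n z)) else 0) ∂ν = ∫ z in B, T h z ∂ν :=
    integral_congr_ae (Eventually.of_forall fun z => (hT h z).symm)
  have hRHS : ∫ z, (B.indicator (fun _ => (1 : ℝ)) z -
        (ν[B.indicator (fun _ => (1 : ℝ)) | MeasurableSpace.comap (fun z => past Φ r z i n) inferInstance]) z) *
      (if n < cnt Φ τ z i then
        (if t₁ < Φ.nthCollisionTimeOf i n z ∧ Φ.nthCollisionTimeOf i n z ≤ t₂ then (1 : ℝ) else 0) *
          (h i n (past Φ r z i n) * (g (kick Φ i n z) - kappa Φ r g i n z)) else 0) ∂ν =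
      ∫ z, (B.indicator (fun _ => (1 : ℝ)) z -
        (ν[B.indicator (fun _ => (1 : ℝ)) | MeasurableSpace.comap (fun z => past Φ r z i n) inferInstance]) z) * T h z ∂ν :=
    integral_congr_ae (Eventually.of_forall fun z => by simp only [hT])
  rw [hLHS, hRHS]
  calc ∫ z in B, T h z ∂ν = ∫ z, B.indicator (T h) z ∂ν := (integral_indicator hB).symm
    _ = ∫ z, B.indicator (fun _ => (1 : ℝ)) z * T h z ∂ν := by
        refine integral_congr_ae (Eventually.of_forall fun z => ?_)
        by_cases hz : z ∈ B <;> simp [hz]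
    _ = ∫ z, B.indicator (fun _ => (1 : ℝ)) z * T h z ∂ν -
          ∫ z, (ν[B.indicator (fun _ => (1 : ℝ)) | MeasurableSpace.comap (fun z => past Φ r z i n) inferInstance]) z *
            T h z ∂ν := by rw [hpred, sub_zero]
    _ = ∫ z, (B.indicator (fun _ => (1 : ℝ)) z -
          (ν[B.indicator (fun _ => (1 : ℝ)) | MeasurableSpace.comap (fun z => past Φ r z i n) inferInstance]) z) * T h z ∂ν := by
        rw [← integral_sub hind_int hcond_int]
        refine integral_congr_ae (Eventually.of_forall fun z => ?_)
        ring

/-- **Registered sub-goal `biasInnovation` (fully quantified form of `setIntegral_windowTerm_eq_integral_innovation`).** [folklore] -/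
theorem biasInnovation : ∀ (σ : ℝ) (N : ℕ), 0 < σ → σ ≤ 1 / 2 → ∀ (Φ : Flow σ N) (τ r t₁ t₂ : ℝ)
    (g : V3 × V3 × V3 → ℝ), Continuous g → (∃ C : ℝ, ∀ p, |g p| ≤ C) →
    ∀ (h : Fin (N + 1) → ℕ → Past N → ℝ), (∀ i n, Measurable (h i n)) → (∃ Ch : ℝ, ∀ i n p, |h i n p| ≤ Ch) →
    ∀ (B : Set (Phase N)), MeasurableSet B → ∀ (i : Fin (N + 1)) (n : ℕ),
    ∫ z in B, (if n < cnt Φ τ z i then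
        (if t₁ < Φ.nthCollisionTimeOf i n z ∧ Φ.nthCollisionTimeOf i n z ≤ t₂ then (1 : ℝ) else 0) *
          (h i n (past Φ r z i n) * (g (kick Φ i n z) - kappa Φ r g i n z)) else 0)
      ∂(localGibbsLaw σ (fun _ => 1) (fun _ => 0) (fun _ => 1) N Φ) =
    ∫ z, (B.indicator (fun _ => (1 : ℝ)) z -
        ((localGibbsLaw σ (fun _ => 1) (fun _ => 0) (fun _ => 1) N Φ)[B.indicator (fun _ => (1 : ℝ)) |
          MeasurableSpace.comap (fun z => past Φ r z i n) inferInstance]) z) *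
      (if n < cnt Φ τ z i then
        (if t₁ < Φ.nthCollisionTimeOf i n z ∧ Φ.nthCollisionTimeOf i n z ≤ t₂ then (1 : ℝ) else 0) *
          (h i n (past Φ r z i n) * (g (kick Φ i n z) - kappa Φ r g i n z)) else 0)
      ∂(localGibbsLaw σ (fun _ => 1) (fun _ => 0) (fun _ => 1) N Φ) :=
  fun _ _ hσ hσ2 Φ τ r t₁ t₂ _ hg hgb _ hh hhb _ hB i n =>
    setIntegral_windowTerm_eq_integral_innovation hσ hσ2 Φ τ r t₁ t₂ hg hgb hh hhb hB i n

end Summit.AtomisticToContinuum.HydrodynamicLimit.Theorems.KickFairRelEquilibriumMesoLine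

end
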